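import Mathlib
import Literature.Barriers.ValiantsHypothesis.AlgebraicNaturalProofs
import Summits.ValiantsHypothesis.ValiantsHypothesis.Theorems.BarrierLeverPartitionMinorsHitByVPOrProjections

/-!
# Route BarrierLever — item `PartitionMinorsHitByVP` (stmt-ValiantsHypothesis-19717):
# HAMMING-BALL UNIVERSALITY for the additive door (conjecture T1, typed) and the classes it would give

Helper file (`--supports stmt-ValiantsHypothesis-19717`; cell valiant-natproofs, rung V4, 𝒟-side,
prover seat val-np-p6 gen 4). Definition-free. Closes NO item. It TYPES, as an explicit hypothesis,
the seat's conjecture T1 and records the two layout classes of item 19717 that T1 delivers through the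
additive door (`…AdditiveDoor.partitionMinor_hit_of_additive_mem`, p506404) and its `x ↔ y` mirror
(`…OrProjections.partitionMinor_hit_symm`, p507603). Nothing here is asserted unconditionally.

T1 («full-support Hamming balls are universal rows of the additive table»). Fix `h` and `e`. If the
rows `u i` run through EVERY subset of `Fin h` of size `≤ e` exactly once (so `r = C(h, ≤ e)`), then for
EVERY injective column family `w` some additive table `(ω₀, ω)` makes
`det [∏_{c ∈ w j} (ω₀ c + Σ_{a ∈ u i} ω a c)]_{i,j} ≠ 0`. Equivalently: a generic affine image of the
ball `B([h], e) ⊆ {0,1}^h` is unisolvent for every `C(h,≤e)`-set of square-free monomials; equivalently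
every nonzero multilinear polynomial vanishing on a generic affine copy of `B([h], e)` has more than
`C(h, ≤ e)` monomials. Why balls: they are exactly the 0/1 point sets with GENERIC affine Hilbert
function `H(d) = C(h, ≤ d)`, so none of the Hilbert-type obstructions (`…AdditiveObstruction`,
`…AdditiveDoubleObstruction`, and the sub-family / two-star obstructions of memo RESIDUE-v6) can occur.

* **`partitionMinor_hit_ballRows_of_universal`** — under T1(h, e) (stated inline as `hyp`), every layout
  whose rows are exactly the ball `B([h], e)` and whose columns are ANY injective family is hit in
  `SmallCircuits ℂ (h+h) 5` (`h ≥ 2`).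
* **`partitionMinor_hit_ballColumns_of_universal`** — the mirror: ANY injective rows × columns exactly
  the ball `B([h], e)`; `r = C(h, ≤ e)` is exponential in `h` for `e = ⌊h/2⌋`, and ball columns are
  neither faces nor binary-contiguous (`…BinaryContiguous`), nor OR-projections, nor automorphic images.

EVIDENCE for T1 (kit j276484 part A, `--workitem 19717`; exact arithmetic mod 2⁶¹−1, two independent
random tables, «singular» = both vanish): 0 singular column families among — `h = 4`: `e = 1, 2, 3`
EXHAUSTIVE over all `C(16, N)` families; `h = 5`: `e = 1` EXHAUSTIVE (906 192 families), `e = 2`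
(300 000 random + 23 structured: co-balls, stars, cubes with filler, shifted balls, size windows,
complements), `e = 3` (60 000 + 22), `e = 4` exhaustive; `h = 6`: `e = 2, 3, 4` (60 000 / 15 000 / 4 000),
`e = 5` exhaustive; `h = 7`: `e = 2, 3` (20 000 / 2 500). Special tables that already work at `h = 4`
(exhaustive) and `h = 5` (sampled): `ω a c = d_c·[a = c] + r_a s_c` and the rigid `ℓ_c(S) = |S| + α_c·[c ∉ S]`;
tables that fail for some families: diagonal (product state), triangular, bidiagonal; the polarization
limit (rectangular permanents) fails — a proof must use the finite affine structure.

WHAT THIS IS NOT: T1 is a CONJECTURE (hypothesis `hyp`); nothing on crux 14610 or VP vs VNP.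
-/

set_option linter.dupNamespace false

namespace Summit.ValiantsHypothesis.ValiantsHypothesis.Theorems.BarrierLever.AdditiveDoor

open Finset MvPolynomial
open Literature.Barriers.ValiantsHypothesis

noncomputable section

/-- **Ball rows × arbitrary columns, under T1(h, e).** If every layout whose row family is exactly the
Hamming ball `B([h], e)` admits a nonsingular additive table (hypothesis `hyp` = conjecture T1(h,e)),
then every such layout is hit in `SmallCircuits ℂ (h+h) 5` (`h ≥ 2`). -/
theorem partitionMinor_hit_ballRows_of_universal (h e : ℕ) (hh : 2 ≤ h)
    (hyp : ∀ (r : ℕ) (u w : Fin r → Finset (Fin h)), Function.Injective u → Function.Injective w →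
      (∀ i, (u i).card ≤ e) → (∀ S : Finset (Fin h), S.card ≤ e → ∃ i, u i = S) →
      ∃ (ω₀ : Fin h → ℂ) (ω : Fin h → Fin h → ℂ),
        (Matrix.of fun i j : Fin r => ∏ c ∈ w j, (ω₀ c + ∑ a ∈ u i, ω a c)).det ≠ 0)
    {r : ℕ} (u w : Fin r → Finset (Fin h)) (hu : Function.Injective u) (hw : Function.Injective w)
    (hsmall : ∀ i, (u i).card ≤ e) (hall : ∀ S : Finset (Fin h), S.card ≤ e → ∃ i, u i = S) :
    ∃ f ∈ SmallCircuits ℂ (h + h) 5,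
      (Matrix.of fun i j : Fin r => MvPolynomial.coeff
        (∑ a ∈ u i, Finsupp.single (Fin.castAdd h a) 1 +
          ∑ c ∈ w j, Finsupp.single (Fin.natAdd h c) 1) f).det ≠ 0 := by
  obtain ⟨ω₀, ω, hdet⟩ := hyp r u w hu hw hsmall hall
  exact partitionMinor_hit_of_additive_mem h hh u w ω₀ ω hdet

/-- **Arbitrary rows × ball columns, under T1(h, e)** (the mirror class; `r = C(h, ≤ e)`, exponential in
`h` for `e = ⌊h/2⌋`). -/
theorem partitionMinor_hit_ballColumns_of_universal (h e : ℕ) (hh : 2 ≤ h)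
    (hyp : ∀ (r : ℕ) (u w : Fin r → Finset (Fin h)), Function.Injective u → Function.Injective w →
      (∀ i, (u i).card ≤ e) → (∀ S : Finset (Fin h), S.card ≤ e → ∃ i, u i = S) →
      ∃ (ω₀ : Fin h → ℂ) (ω : Fin h → Fin h → ℂ),
        (Matrix.of fun i j : Fin r => ∏ c ∈ w j, (ω₀ c + ∑ a ∈ u i, ω a c)).det ≠ 0)
    {r : ℕ} (u w : Fin r → Finset (Fin h)) (hu : Function.Injective u) (hw : Function.Injective w)
    (hsmall : ∀ j, (w j).card ≤ e) (hall : ∀ S : Finset (Fin h), S.card ≤ e → ∃ j, w j = S) :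
    ∃ f ∈ SmallCircuits ℂ (h + h) 5,
      (Matrix.of fun i j : Fin r => MvPolynomial.coeff
        (∑ a ∈ u i, Finsupp.single (Fin.castAdd h a) 1 +
          ∑ c ∈ w j, Finsupp.single (Fin.natAdd h c) 1) f).det ≠ 0 := by
  obtain ⟨ω₀, ω, hdet⟩ := hyp r w u hw hu hsmall hall
  exact partitionMinor_hit_symm h 5 u w (partitionMinor_hit_of_additive_mem h hh w u ω₀ ω hdet)

end

end Summit.ValiantsHypothesis.ValiantsHypothesis.Theorems.BarrierLever.AdditiveDoor
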